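import Mathlib
import Summits.NavierStokesRegularity.NavierStokesRegularity.Theorems.EulerZoomLiouvillePowerGaugeEulerLiouvilleMomentFloorGlue

/-!
# nsreg-p2 ROUND-53 «THE FLOOR» — t57-F2: the SHARP-BALL LIMIT LAW from the TWO-SIDED MOMENT LAW (the bump sandwich)

Crux `EulerZoomLiouville.PowerGaugeEulerLiouville` (stmt-NavierStokesRegularity-19832); width seat ns-ezl-w2 g6 (plate t57-F2, unkeyed/decorative in
ROUND-53 §7).  `sharpMomentLimitLaw_of_twoSidedMomentLaw (hρ : 0 ≤ ρ) (hρ1 : ρ ≤ 1) : MomentFloor.TwoSidedMomentLaw ρ V → MomentFloor.SharpMomentLimitLaw ρ V`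
(faces of `…MomentFloorGlue`, Sketch53 §A (F1), (F2)): if for every compactly supported `C¹` weight `g` the normalised weighted moment
`R^{q(2+ρ)−3}∫ g(R⁻¹y)‖Ω‖^q` converges with a rate, then the sharp-ball moment `R^{q(2+ρ)−3}∫_{B_R}‖Ω‖^q` converges.
Proof = the DILATION SANDWICH (`tendsto_of_dilationSandwich`, class-free): with a bump `g_δ = 1` on `B̄₁`, supported in `B_{1+δ}`,
`S(R) ≤ m_δ(R)` and `(1+δ)^a m_δ(R/(1+δ)) ≤ S(R)` (`a = q(2+ρ)−3 ∈ [−3,0]`), so `S` is eventually squeezed in an interval of width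
`(1 − (1+δ)^a)·L_δ + O(R₀^{−d}) ≤ 56δB + o(1)`: `S` is Cauchy along `R → ∞`.

HONEST FRAMING: class-free real analysis about HYPOTHETICAL profiles (MODEL-lattice instrument); (F1) itself is NOT proved here (sfl-p1 lineage, t57-F1);
nothing about the crux E (19832 OPEN) or NS regularity is proved; not E. [nsreg-p2 R53 §2 (F2); folklore]
-/

noncomputable section

set_option linter.dupNamespace false

namespace Summit.NavierStokesRegularity.NavierStokesRegularity.Theorems.PowerGaugeEulerLiouville.MomentFloor

open MeasureTheory Set Filter Topology Metric Function Literature.Analysis.FluidPDE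
open scoped RealInnerProductSpace ENNReal

/-! ### The dilation sandwich (class-free) -/

/-- Elementary: for `0 < δ ≤ 1` and `−3 ≤ a ≤ 0`, `(1+δ)^a ≤ 1`, `(1+δ)^{−a} ≤ 8` and `1 − (1+δ)^a ≤ 7δ`. [folklore] -/
theorem dilation_rpow_bounds {a δ : ℝ} (ha : a ≤ 0) (ha3 : -3 ≤ a) (hδ : 0 < δ) (hδ1 : δ ≤ 1) :
    (1 + δ) ^ a ≤ 1 ∧ (1 + δ) ^ (-a) ≤ 8 ∧ 1 - (1 + δ) ^ a ≤ 7 * δ := by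
  have h1 : (1 : ℝ) ≤ 1 + δ := by linarith
  have h0 : (0 : ℝ) < 1 + δ := by linarith
  have hu : (1 + δ) ^ a ≤ 1 := Real.rpow_le_one_of_one_le_of_nonpos h1 ha
  have hv3 : (1 + δ) ^ (-a) ≤ (1 + δ) ^ (3 : ℝ) := Real.rpow_le_rpow_of_exponent_le h1 (by linarith)
  have hcube : (1 + δ) ^ (3 : ℝ) = (1 + δ) ^ (3 : ℕ) := by exact_mod_cast Real.rpow_natCast (1 + δ) 3
  have hd2 : δ ^ 2 ≤ δ := by nlinarith
  have hd3 : δ ^ 3 ≤ δ := by nlinarith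
  have h7 : (1 + δ) ^ (3 : ℕ) ≤ 1 + 7 * δ := by
    have e : (1 + δ) ^ (3 : ℕ) = 1 + 3 * δ + 3 * δ ^ 2 + δ ^ 3 := by ring
    rw [e]; linarith
  have hv7 : (1 + δ) ^ (-a) ≤ 1 + 7 * δ := by rw [hcube] at hv3; exact hv3.trans h7
  have huv : (1 + δ) ^ a * (1 + δ) ^ (-a) = 1 := by
    rw [Real.rpow_neg h0.le, mul_inv_cancel₀ (Real.rpow_pos_of_pos h0 a).ne']
  have hupos : 0 < (1 + δ) ^ a := Real.rpow_pos_of_pos h0 a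
  generalize (1 + δ) ^ a = u at hu huv hupos ⊢
  generalize (1 + δ) ^ (-a) = v at hv7 huv ⊢
  refine ⟨hu, by linarith, ?_⟩
  nlinarith [mul_le_mul_of_nonneg_right hu (show 0 ≤ v - 1 by nlinarith)]

/-- **THE DILATION SANDWICH** (class-free).  Let `S : ℝ → ℝ` be non-negative and bounded by `B` on `[1, ∞)`, `−3 ≤ a ≤ 0`, and suppose that for
every `δ ∈ (0,1]` there is a function `m` converging at `∞` with a power rate (`|m(R) − L| ≤ C R^{−d}`, `R ≥ 1`) which squeezes `S`:
`S(R) ≤ m(R)` (`R ≥ 1`) and `(1+δ)^a·m(R/(1+δ)) ≤ S(R)` (`R ≥ 1+δ`).  Then `S` converges as `R → ∞`. [folklore] -/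
theorem tendsto_of_dilationSandwich {S : ℝ → ℝ} {a B : ℝ} (ha : a ≤ 0) (ha3 : -3 ≤ a)
    (hS0 : ∀ R, 1 ≤ R → 0 ≤ S R) (hSB : ∀ R, 1 ≤ R → S R ≤ B)
    (hyp : ∀ δ : ℝ, 0 < δ → δ ≤ 1 → ∃ (m : ℝ → ℝ) (L C d : ℝ), 0 < d ∧
      (∀ R, 1 ≤ R → S R ≤ m R) ∧ (∀ R, 1 + δ ≤ R → (1 + δ) ^ a * m (R / (1 + δ)) ≤ S R) ∧
      (∀ R, 1 ≤ R → |m R - L| ≤ C * R ^ (-d))) :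
    ∃ ℓ : ℝ, Tendsto S atTop (𝓝 ℓ) := by
  have hB0 : 0 ≤ B := (hS0 1 le_rfl).trans (hSB 1 le_rfl)
  refine cauchySeq_tendsto_of_complete (Metric.cauchySeq_iff'.2 fun ε hε => ?_)
  -- choose `δ` with `56 δ B ≤ ε/4`
  set δ : ℝ := min 1 (ε / (4 * (56 * B + 1))) with hδdef
  have hδ0 : 0 < δ := lt_min one_pos (by positivity)
  have hδ1 : δ ≤ 1 := min_le_left _ _
  have hδB : 56 * δ * B ≤ ε / 4 := by
    have h1 : δ ≤ ε / (4 * (56 * B + 1)) := min_le_right _ _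
    have h2 : δ * (4 * (56 * B + 1)) ≤ ε := by rwa [le_div_iff₀ (by positivity)] at h1
    nlinarith
  obtain ⟨m, L, C, d, hd, h1, h2, h3⟩ := hyp δ hδ0 hδ1
  obtain ⟨hu1, hv8, h7δ⟩ := dilation_rpow_bounds ha ha3 hδ0 hδ1
  have hC0 : 0 ≤ C := by
    have := h3 1 le_rfl
    rw [Real.one_rpow, mul_one] at this
    exact (abs_nonneg _).trans this
  have hδp : (0 : ℝ) < 1 + δ := by linarith
  -- choose `T ≥ 1` with `9 C T^{−d} < ε/4`
  have hT : ∃ T : ℝ, 1 ≤ T ∧ 9 * C * T ^ (-d) < ε / 4 := by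
    have ht : Tendsto (fun T : ℝ => 9 * C * T ^ (-d)) atTop (𝓝 (9 * C * 0)) :=
      (tendsto_rpow_neg_atTop hd).const_mul _
    rw [mul_zero] at ht
    obtain ⟨T, hT⟩ := ((ht.eventually (gt_mem_nhds (by positivity : (0 : ℝ) < ε / 4))).and
      (eventually_ge_atTop 1)).exists
    exact ⟨T, hT.2, hT.1⟩
  obtain ⟨T, hT1, hT⟩ := hT
  set ρ₂ : ℝ := T ^ (-d) with hρ₂
  have hρ₂0 : 0 ≤ ρ₂ := Real.rpow_nonneg (by linarith) _
  -- the squeeze interval on `[R₀, ∞)`, `R₀ = (1+δ)T`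
  set R₀ : ℝ := (1 + δ) * T with hR₀
  have hR₀1 : 1 + δ ≤ R₀ := by rw [hR₀]; nlinarith
  have hR₀T : T ≤ R₀ := by rw [hR₀]; nlinarith
  -- upper bound for `L`: `L ≤ 8B + Cρ₂`
  have hL : L ≤ 8 * B + C * ρ₂ := by
    have hm : m T ≤ (1 + δ) ^ (-a) * S ((1 + δ) * T) := by
      have h := h2 ((1 + δ) * T) (by nlinarith)
      rw [mul_div_cancel_left₀ T hδp.ne'] at h
      rw [Real.rpow_neg hδp.le, ← div_eq_inv_mul, le_div_iff₀ (Real.rpow_pos_of_pos hδp a), mul_comm]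
      exact h
    have hSB' : S ((1 + δ) * T) ≤ B := hSB _ (by nlinarith)
    have hmB : m T ≤ 8 * B :=
      hm.trans ((mul_le_mul_of_nonneg_left hSB' (Real.rpow_nonneg hδp.le _)).trans (mul_le_mul_of_nonneg_right hv8 hB0))
    have h := h3 T hT1
    rw [abs_le] at h
    linarith [h.1]
  have hup : ∀ n, R₀ ≤ n → S n ≤ L + C * ρ₂ := by
    intro n hn
    have hn1 : 1 ≤ n := by linarith
    have h := h3 n hn1
    rw [abs_le] at h
    have hρ : n ^ (-d) ≤ ρ₂ := Real.rpow_le_rpow_of_nonpos (by linarith) (by linarith) (by linarith)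
    have := h1 n hn1
    nlinarith [mul_le_mul_of_nonneg_left hρ hC0]
  have hlow : ∀ n, R₀ ≤ n → (1 + δ) ^ a * L - C * ρ₂ ≤ S n := by
    intro n hn
    have hn' : 1 ≤ n / (1 + δ) := by rw [le_div_iff₀ hδp]; linarith
    have h := h3 (n / (1 + δ)) hn'
    rw [abs_le] at h
    have hρ : (n / (1 + δ)) ^ (-d) ≤ ρ₂ :=
      Real.rpow_le_rpow_of_nonpos (by linarith) (by rw [le_div_iff₀ hδp]; linarith) (by linarith)
    have hsand := h2 n (by linarith)
    have hupos : 0 ≤ (1 + δ) ^ a := Real.rpow_nonneg hδp.le _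
    -- `(1+δ)^a (L − Cρ₂) ≤ (1+δ)^a m(n/(1+δ)) ≤ S n`, and `(1+δ)^a ≤ 1`
    have hm : L - C * ρ₂ ≤ m (n / (1 + δ)) := by nlinarith [mul_le_mul_of_nonneg_left hρ hC0]
    have h4 : (1 + δ) ^ a * (L - C * ρ₂) ≤ S n := (mul_le_mul_of_nonneg_left hm hupos).trans hsand
    nlinarith [mul_le_mul_of_nonneg_left (mul_nonneg hC0 hρ₂0) hupos]
  -- the width
  have hwidth : (L + C * ρ₂) - ((1 + δ) ^ a * L - C * ρ₂) ≤ ε / 2 := by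
    have hgap : (1 - (1 + δ) ^ a) * L ≤ 56 * δ * B + 7 * (C * ρ₂) := by
      by_cases hL0 : 0 ≤ L
      · calc (1 - (1 + δ) ^ a) * L ≤ (7 * δ) * (8 * B + C * ρ₂) :=
            mul_le_mul h7δ hL (by exact hL0) (by positivity)
          _ = 56 * δ * B + 7 * δ * (C * ρ₂) := by ring
          _ ≤ 56 * δ * B + 7 * (C * ρ₂) := by nlinarith [mul_nonneg hC0 hρ₂0]
      · have : (1 - (1 + δ) ^ a) * L ≤ 0 := mul_nonpos_of_nonneg_of_nonpos (by linarith) (le_of_lt (not_le.1 hL0))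
        nlinarith [mul_nonneg hC0 hρ₂0]
    have h9 : 9 * C * ρ₂ < ε / 4 := hT
    nlinarith
  refine ⟨R₀, fun n hn => ?_⟩
  rw [Real.dist_eq]
  have hn' := hup n hn
  have hn'' := hlow n hn
  have hN' := hup R₀ le_rfl
  have hN'' := hlow R₀ le_rfl
  rw [abs_lt]
  constructor <;> linarith

/-! ### The sharp-ball limit law from the two-sided law -/

/-- **t57-F2: `TwoSidedMomentLaw ρ V → SharpMomentLimitLaw ρ V` for `0 ≤ ρ ≤ 1`** (the bump sandwich: a `ContDiffBump` equal to `1` on `B̄₁`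
and supported in `B_{1+δ}`, dilated to scale `R`, squeezes the sharp-ball moment between two weighted moments which (F1) makes converge;
`tendsto_of_dilationSandwich`). [nsreg-p2 R53 §2 (F2)] -/
theorem sharpMomentLimitLaw_of_twoSidedMomentLaw {ρ : ℝ} (hρ : 0 ≤ ρ) (hρ1 : ρ ≤ 1)
    {V : EuclideanSpace ℝ (Fin 3) → EuclideanSpace ℝ (Fin 3)} (hF1 : TwoSidedMomentLaw ρ V) : SharpMomentLimitLaw ρ V := by
  intro P hprof q hq0 hq1 hE hA
  have hV2 : ContDiff ℝ 2 V := hprof.contDiff_velocity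
  have hΩc : Continuous (curl V) := (contDiff_curl (n := 1) (by exact_mod_cast hV2)).continuous
  set f : EuclideanSpace ℝ (Fin 3) → ℝ := fun y => ‖curl V y‖ ^ q with hf
  have hfc : Continuous f := hΩc.norm.rpow_const fun _ => Or.inr hq0.le
  have hf0 : ∀ y, 0 ≤ f y := fun y => Real.rpow_nonneg (norm_nonneg _) _
  have hfi : ∀ R : ℝ, IntegrableOn f (ball (0 : EuclideanSpace ℝ (Fin 3)) R) volume := fun R =>
    (hfc.continuousOn.integrableOn_compact (isCompact_closedBall (0 : EuclideanSpace ℝ (Fin 3)) R)).mono_set ball_subset_closedBall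
  set a : ℝ := q * (2 + ρ) - 3 with ha
  have ha0 : a ≤ 0 := by rw [ha]; nlinarith
  have ha3 : -3 ≤ a := by rw [ha]; nlinarith
  set S : ℝ → ℝ := fun R => R ^ a * ∫ y in ball (0 : EuclideanSpace ℝ (Fin 3)) R, f y with hS
  -- ### the squeeze for a given `δ`
  have hsq : ∀ δ : ℝ, 0 < δ → δ ≤ 1 → ∃ (m : ℝ → ℝ) (L C d : ℝ), 0 < d ∧
      (∀ R, 1 ≤ R → S R ≤ m R) ∧ (∀ R, 1 + δ ≤ R → (1 + δ) ^ a * m (R / (1 + δ)) ≤ S R) ∧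
      (∀ R, 1 ≤ R → |m R - L| ≤ C * R ^ (-d)) := by
    intro δ hδ hδ1
    let g : ContDiffBump (0 : EuclideanSpace ℝ (Fin 3)) := ⟨1, 1 + δ, one_pos, by linarith⟩
    have hgc : ContDiff ℝ 1 (g : EuclideanSpace ℝ (Fin 3) → ℝ) := g.contDiff
    have hgs : HasCompactSupport (g : EuclideanSpace ℝ (Fin 3) → ℝ) := g.hasCompactSupport
    obtain ⟨C, hC⟩ := hF1 P hprof hE hA g hgc hgs q hq0 hq1
    obtain ⟨L, hL⟩ := hC q hq0 le_rfl
    refine ⟨fun R => R ^ a * ∫ y, g (R⁻¹ • y) * f y, L, C, (1 - q) * (1 + ρ / 2), by nlinarith, ?_, ?_, ?_⟩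
    · -- `S R ≤ m R`: `g(R⁻¹y) = 1` on `B_R`
      intro R hR
      have hR0 : 0 < R := by linarith
      have hgi : Integrable (fun y => g (R⁻¹ • y) * f y) volume := by
        refine Continuous.integrable_of_hasCompactSupport
          ((g.continuous.comp (continuous_const_smul R⁻¹)).mul hfc) ?_
        refine HasCompactSupport.intro (isCompact_closedBall (0 : EuclideanSpace ℝ (Fin 3)) ((1 + δ) * R)) fun y hy => ?_
        rw [mem_closedBall, dist_zero_right, not_le] at hy
        have : g (R⁻¹ • y) = 0 := by
          refine g.zero_of_le_dist ?_
          rw [dist_zero_right, norm_smul, norm_inv, Real.norm_of_nonneg hR0.le]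
          change 1 + δ ≤ R⁻¹ * ‖y‖
          rw [le_inv_mul_iff₀ hR0]
          nlinarith
        rw [this, zero_mul]
      refine mul_le_mul_of_nonneg_left ?_ (Real.rpow_nonneg hR0.le _)
      calc ∫ y in ball (0 : EuclideanSpace ℝ (Fin 3)) R, f y
          = ∫ y in ball (0 : EuclideanSpace ℝ (Fin 3)) R, g (R⁻¹ • y) * f y := by
            refine setIntegral_congr_fun measurableSet_ball fun y hy => ?_
            have : g (R⁻¹ • y) = 1 := by
              refine g.one_of_mem_closedBall ?_
              rw [mem_closedBall, dist_zero_right, norm_smul, norm_inv, Real.norm_of_nonneg hR0.le]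
              change R⁻¹ * ‖y‖ ≤ 1
              rw [inv_mul_le_iff₀ hR0, mul_one]
              exact (mem_ball_zero_iff.1 hy).le
            rw [this, one_mul]
        _ ≤ ∫ y, g (R⁻¹ • y) * f y :=
            setIntegral_le_integral hgi (ae_of_all _ fun y => mul_nonneg (g.nonneg) (hf0 y))
    · -- `(1+δ)^a m(R/(1+δ)) ≤ S R`: `g((R/(1+δ))⁻¹y)` vanishes off `B_R` and is `≤ 1`
      intro R hR
      have hR0 : 0 < R := by linarith
      have hδp : (0 : ℝ) < 1 + δ := by linarith
      set R' : ℝ := R / (1 + δ) with hR'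
      have hR'0 : 0 < R' := div_pos hR0 hδp
      have hRR' : (1 + δ) * R' = R := by rw [hR']; field_simp
      have hle : ∫ y, g (R'⁻¹ • y) * f y ≤ ∫ y in ball (0 : EuclideanSpace ℝ (Fin 3)) R, f y := by
        have hzero : ∀ y, y ∉ ball (0 : EuclideanSpace ℝ (Fin 3)) R → g (R'⁻¹ • y) * f y = 0 := by
          intro y hy
          rw [mem_ball_zero_iff, not_lt] at hy
          have : g (R'⁻¹ • y) = 0 := by
            refine g.zero_of_le_dist ?_
            rw [dist_zero_right, norm_smul, norm_inv, Real.norm_of_nonneg hR'0.le]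
            change 1 + δ ≤ R'⁻¹ * ‖y‖
            rw [le_inv_mul_iff₀ hR'0, mul_comm, ← hRR'] at *
            nlinarith
          rw [this, zero_mul]
        rw [← setIntegral_eq_integral_of_forall_compl_eq_zero hzero]
        refine setIntegral_mono_on ?_ (hfi R) measurableSet_ball fun y _ => ?_
        · exact ((hfi R).integrable.mono' (((g.continuous.comp (continuous_const_smul R'⁻¹)).mul hfc).aestronglyMeasurable.restrict)
            (ae_of_all _ fun y => by
              rw [Real.norm_of_nonneg (mul_nonneg g.nonneg (hf0 y))]
              exact mul_le_of_le_one_left (hf0 y) g.le_one))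
        · exact mul_le_of_le_one_left (hf0 y) g.le_one
      have hpow : (1 + δ) ^ a * R' ^ a = R ^ a := by
        rw [← Real.mul_rpow hδp.le hR'0.le, hRR']
      calc (1 + δ) ^ a * (R' ^ a * ∫ y, g (R'⁻¹ • y) * f y) = R ^ a * ∫ y, g (R'⁻¹ • y) * f y := by
            rw [← mul_assoc, hpow]
        _ ≤ R ^ a * ∫ y in ball (0 : EuclideanSpace ℝ (Fin 3)) R, f y :=
            mul_le_mul_of_nonneg_left hle (Real.rpow_nonneg hR0.le _)
    · intro R hR
      exact hL R hR
  -- ### the bound `S ≤ B` from the `δ = 1` squeeze, and `S ≥ 0`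
  have hS0 : ∀ R, 1 ≤ R → 0 ≤ S R := fun R hR =>
    mul_nonneg (Real.rpow_nonneg (by linarith) _) (setIntegral_nonneg measurableSet_ball fun y _ => hf0 y)
  obtain ⟨m₁, L₁, C₁, d₁, hd₁, h1₁, -, h3₁⟩ := hsq 1 one_pos le_rfl
  have hC₁ : 0 ≤ C₁ := by
    have := h3₁ 1 le_rfl
    rw [Real.one_rpow, mul_one] at this
    exact (abs_nonneg _).trans this
  have hSB : ∀ R, 1 ≤ R → S R ≤ L₁ + C₁ := by
    intro R hR
    have h := h3₁ R hR
    rw [abs_le] at h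
    have hρ : R ^ (-d₁) ≤ 1 := Real.rpow_le_one_of_one_le_of_nonpos hR (by linarith)
    nlinarith [h1₁ R hR, mul_le_mul_of_nonneg_left hρ hC₁]
  exact tendsto_of_dilationSandwich ha0 ha3 hS0 hSB hsq

end Summit.NavierStokesRegularity.NavierStokesRegularity.Theorems.PowerGaugeEulerLiouville.MomentFloor

end
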